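import Summits.QuantumFields.YangMills.Theorems.BalabanLadderIRColdPressurePincer
import Summits.QuantumFields.YangMills.Theorems.DoublingDefectRecursionToGapColdDefect
import HarnessLib

/-!
# The aspect-ratio bootstrap: `[TM-aniso] → ColdDoublingRecursionSC` — LANDABLE CUT (no `sorry`) of line `aspect-bootstrap`

LANDING NOTE (ideator ym-ir-idea-6 g2 for prover `ym-ir-line-ab-p1`): this is `Cruxes/IR/Lines/aspect_bootstrap.lean` rev 2 with the one
stub `stub_tracePositive` and `R_of_stubs` REMOVED and the namespace moved to `…Theorems.AspectBootstrap`; headline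
`R_of_tracePositive`.  Proposed target: `Summits/QuantumFields/YangMills/Theorems/AspectBootstrapColdDoublingRecursion.lean` (your call;
`ledger propose` is yours).  The remaining hypothesis [TM-aniso] is the anisotropic re-typing of
`Literature…exists_spectralData_wilsonFinTorusPartition` (adaptation map: WAKE-line-ab-p1.md §2 (L3)).  Original header follows.

# Line `aspect-bootstrap` on crux `BalabanLadder.IR` (stmt-QuantumFields-19354, rung R2c) — the MECHANISM for the
load `R = ColdDoublingRecursionSC` of lines `floor-handshake` / `doubling-bridge`, KERNEL-CHECKED in the abstract

Cell ym-ir, seat ym-ir-idea-6 g2 (lens: finite-size-scaling typed conjectures), LINE 3.  Slot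
`Cruxes/IR/Lines/aspect_bootstrap.lean`; the skeleton of record stays `Cruxes/IR/Lines/af_pincer_Uc_sharp.lean`.

HONEST FRAMING.  The Yang–Mills mass gap (Clay) is NOT proved by anything here.  R4 (`BalabanUVStability4`) closes only
the conditional finite-𝕋⁴ rung `BalabanLadder.UV`.  This file DISCHARGES one stub of one alternative line — the
contraction `R = ColdDoublingRecursionSC` (census B15 «missing bootstrap»; graded «≈ S given E / no mechanism located» by
both critics) — modulo ONE piece of typing INFRASTRUCTURE about Wilson's anisotropic four-torus: [TM-aniso], the
transfer-matrix trace formula for non-cubic spatial boxes (the tree has the cubic case,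
`exists_spectralData_wilsonFinTorusPartition`).  Rev 2: the other two model facts are PROVED here — [Sym] axis symmetry
(`axisSymmetric`) and [Vol] the volume bounds (`volumeBounds`).  The mathematics of `R` — the squaring of the cold defect
under spatial extension with ONE β-free constant — is the sorry-free theorem `defectSquaring` below.  The exit `H`/`E` and
the residual `N` of those lines are untouched and remain their whole weight.  0 legs discharged; `R` ceases to be a load.

THE MECHANISM («aspect-ratio bootstrap»; card MECHANISM-ym-ir-idea-6.md).  Let `Z(n₀,n₁,n₂,n₃)` be a family with:
[Sym] invariance under permutations of its four arguments; [TM] for every spatial box `B = (b₁,b₂,b₃)` eigenvalues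
`λ₀(B) ≥ λᵢ(B) ≥ 0`, `λ₀ > 0`, with `Z(B, τ) = Σᵢ λᵢ(B)^τ` (`τ ≥ 2`) — hence, by [Sym], a transfer matrix in EVERY
direction (reflection positivity in all four axes); [Vol] `e^{−A·vol} ≤ Z ≤ 1`.  Write `φ(B) = log λ₀(B)`,
`x_τ(B) = Σ_{i≠0} (λᵢ/λ₀)^τ`, `Y_τ(B) = log Z(B,τ) − τ φ(B) = log(1 + x_τ(B)) ≥ 0` (non-increasing in `τ`), and
`δ(L) = 1 − Z(L³,2t)/Z(L³,t)²`, `t = ⌊L/4⌋` (the cold defect).  Then for `L ≥ 8`, `2L ≤ L' ≤ 4L`: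
 (1) `extension_step` — side extension read in the transposed channel: `L log Z(L',b₁,b₂,τ) ≤ L' log Z(L,b₁,b₂,τ)`
     (ℓᵖ-monotonicity of the spectrum of the box `(τ,b₁,b₂)`, `pow_le_pow_of_le`), so with the CASIMIR SLOPE
     `s := (L'/L) φ(L,b₁,b₂) − φ(L',b₁,b₂)`:  `Y_τ(L',b₁,b₂) ≤ (L'/L) Y_τ(L,b₁,b₂) + τ s`;
 (2) `slope_bound` — the slope is a SLAB-PRESSURE quantity: for every `τ ≥ 2` and `t ≤ L`,
     `τ s ≤ (L'/L) Y_t(τ,b₁,b₂) + Y_2(L',b₁,b₂)`; along the dyadic tower `D_j = (2^j L, b₁, b₂)` with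
     `a_j := Y_t(D_j)/(2^j L)` this gives `s ≤ (L'/L)·sup_j a_j` and, for the tower's own doubling slopes,
     `s_j ≤ 2 sup_i a_i` (the error terms `Y_2/(2^i L)` are sent to zero, `le_of_tendsto_of_tendsto'`);
 (3) `extension_le` — CLOSURE: `a_{j+1} ≤ a_j + t s_j/(2^{j+1} L)` by (1), so `M := sup a ≤ a₀ + θ M` with
     `θ = 2t/L ≤ 1/2`, i.e. `M ≤ 2a₀`, `t s ≤ (L'/L) Y_t(L,b₁,b₂)/2` and `Y_t(L',b₁,b₂) ≤ (3/2)(L'/L) Y_t(L,b₁,b₂)`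
     — the long box needed to bound the Casimir slope IS THE BOX ITSELF because the cold defect lives at aspect
     `L : t = 4 : 1 > 2 : 1` (this is why the aspect-1 defect of route `DoublingDefect`, item 17754, is NOT covered);
     the a-priori bound `a_i ≤ 2A b₁ b₂` that makes `sup a` exist is the only use of [Vol];
 (4) three side extensions, moving the short side to slot 0 by [Sym] each time:
     `Y_t((L')³) ≤ (3L'/2L)³ Y_t(L³) ≤ 216·Y_t(L³)`;
 (5) `defect_facts` + `exc_two_mul_le_sq` — time doubling squares: `t' = ⌊L'/4⌋ ≥ 2t`, `x_{t'} ≤ x_{2t} ≤ x_t²`,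
     `δ < 1/2 ⇒ x_t ≤ 2δ`, `δ ≤ 2x_t`, whence `δ(L') ≤ 2 (e^{432 δ(L)} − 1)² ≤ (2·432²·e^{432}) · δ(L)²`
     (`defectSquaring`) — `R` with a β-FREE constant, `β₀ = 0`, `L₀ = 8` (`coldDoublingRecursionSC_of_model`).
Cheapest falsifier RUN before typing (exact 2D Ising torus, Kaufman 1949; folder `exp/ising2d_check.py`): the four
inequalities `Y_t(2L) ≤ 3Y_t(L)`, `s ≤ 4Y_t(L)/L`, `π(t) ≤ 2Y_t(L)/L`, `Y_{2t}(2L) ≤ log(1+(e^{3Y_t(L)}−1)²)` hold in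
63/63 rows (`K ∈ [0.20, 0.55]` incl. `K_c`, `L ∈ {8,…,64}`); observed `δ(2L)/δ(L)² ≤ 1.1`.

FILE MAP.  §0 the currency, VERBATIM lines `doubling-bridge` / `floor-handshake` (`coldDefect`, `ColdDoublingRecursionSC`;
`Iff.rfl` with those copies once co-imported).  §1 the abstract setting and the SORRY-FREE bootstrap: §1b one-box spectral
bookkeeping (`phi`, `exc`, `Yfun`, `phi_eq_log`, `exists_ratios`, `exc_antitone`, `exc_two_mul_le_sq`, `pow_le_pow_of_le`,
`defect_facts`, …), §1c the family (`slope_bound`, `extension_step`, `extension_le`, `defectSquaring`).  §2 the model: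
[Sym] `axisSymmetric` PROVED (`partition_eq_of_equivariant`: shift-equivariant relabelling + `measurePreserving_piCongrLeft` +
`re_trace_map_inv`), [Vol] `volumeBounds` PROVED (`abs_re_trace_le_card`, `integral_mono`), [TM-aniso] `stub_tracePositive`
(REMOVED in this cut; it is the hypothesis of the headline).  §3 PROVED composition `coldDoublingRecursionSC_of_model`,
`R_of_tracePositive : (∀ G r β ≥ 0, [TM-aniso]) → ColdDoublingRecursionSC`.
-/

noncomputable section

open scoped BigOperators Topology
open Filter MeasureTheory
open Literature.MathematicalPhysics.QuantumFieldTheory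

namespace Summit.QuantumFields.YangMills.Theorems.AspectBootstrap

/-! ## §0 The currency (VERBATIM lines `doubling-bridge` / `floor-handshake`) -/

section Defs

variable {G : Type} [Group G] [TopologicalSpace G] [IsTopologicalGroup G] [CompactSpace G]
  [MeasurableSpace G] [BorelSpace G]

/-- The **cold period-doubling defect** `δᶜ_β(L) = 1 − Z_β(L,L,L,2⌊L/4⌋) / Z_β(L,L,L,⌊L/4⌋)²` (VERBATIM
`FloorHandshake.coldDefect` / `DoublingBridge.coldDefect`). -/
def coldDefect {N : ℕ} (ρ : G →* Matrix (Fin N) (Fin N) ℂ) (β : ℝ) (L : ℕ) : ℝ :=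
  1 - wilsonFinTorusPartition ρ β L L L (2 * (L / 4)) / wilsonFinTorusPartition ρ β L L L (L / 4) ^ 2

end Defs

/-- **R — `ColdDoublingRecursionSC`** (VERBATIM the rank-3 stub of line `floor-handshake` = rank-2 stub `R` of line
`doubling-bridge`; one item by normalised signature): the cold defect contracts quadratically under spatial extension
`L ↦ L' ∈ [2L, 4L]` past thresholds, ONE constant `C` uniform in `β`. -/
def ColdDoublingRecursionSC : Prop :=
  ∀ (G : Type) [Group G] [TopologicalSpace G] [IsTopologicalGroup G] [CompactSpace G],
    IsCompactSimpleLieGroup G → SimplyConnectedSpace G →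
    letI : MeasurableSpace G := borel G
    haveI : BorelSpace G := ⟨rfl⟩
    ∀ r : LatticeRep G, ∃ C β₀ : ℝ, ∃ L₀ : ℕ, 0 < C ∧ ∀ β : ℝ, β₀ ≤ β → ∀ L : ℕ, L₀ ≤ L →
      ∀ L' : ℕ, 2 * L ≤ L' → L' ≤ 4 * L → coldDefect r.ρ β L' ≤ C * coldDefect r.ρ β L ^ 2

/-! ## §1 The abstract setting: axis-symmetric trace-positive partition families -/

/-- [TM] A **spectral datum** for a sequence `z : ℕ → ℝ` (`z τ = Tr 𝕋^τ`, `τ ≥ 2`): non-negative eigenvalues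
`λᵢ ≤ λ_{i₀}`, `λ_{i₀} > 0`, with `Σᵢ λᵢ^{m+2} = z (m+2)` for every `m` (Hilbert–Schmidt positive transfer matrix; exactly
the shape of the tree's CUBIC `exists_spectralData_wilsonFinTorusPartition`). -/
def HasSpectralDatum (z : ℕ → ℝ) : Prop :=
  ∃ (ι : Type) (lam : ι → ℝ) (i₀ : ι), (∀ i, 0 ≤ lam i ∧ lam i ≤ lam i₀) ∧ 0 < lam i₀ ∧
    ∀ m : ℕ, HasSum (fun i => lam i ^ (m + 2)) (z (m + 2))

/-! ## §1b Spectral bookkeeping for ONE box (abstract, elementary) -/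

section OneBox

variable {z : ℕ → ℝ}

/-- `φ(z) := lim_m log z(m)/m` — the logarithm of the top eigenvalue (`phi_eq_log`). -/
def phi (z : ℕ → ℝ) : ℝ := limUnder atTop fun m : ℕ => Real.log (z (m + 2)) / ((m : ℝ) + 2)

/-- The thermal trace excess `x_m(z) := z(m)/e^{m φ(z)} − 1 = Σ_{i ≠ i₀} (λᵢ/λ_{i₀})^m`. -/
def exc (z : ℕ → ℝ) (m : ℕ) : ℝ := z m / Real.exp ((m : ℝ) * phi z) - 1

/-- `Y_m(z) := log z(m) − m φ(z) = log (1 + x_m(z))`. -/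
def Yfun (z : ℕ → ℝ) (m : ℕ) : ℝ := Real.log (z m) - (m : ℝ) * phi z

/-- The sandwich `λ₀^{m+2} ≤ z(m+2) ≤ λ₀^m z(2)` and `z > 0`, for a given datum. -/
theorem datum_bounds {ι : Type} {lam : ι → ℝ} {i₀ : ι} (hle : ∀ i, 0 ≤ lam i ∧ lam i ≤ lam i₀) (hpos : 0 < lam i₀)
    (hsum : ∀ m : ℕ, HasSum (fun i => lam i ^ (m + 2)) (z (m + 2))) (m : ℕ) :
    lam i₀ ^ (m + 2) ≤ z (m + 2) ∧ z (m + 2) ≤ lam i₀ ^ m * z 2 ∧ 0 < z (m + 2) := by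
  have h1 : lam i₀ ^ (m + 2) ≤ z (m + 2) :=
    le_hasSum (hsum m) i₀ fun j _ => pow_nonneg (hle j).1 _
  refine ⟨h1, ?_, lt_of_lt_of_le (pow_pos hpos _) h1⟩
  have h2 : HasSum (fun i => lam i₀ ^ m * lam i ^ (0 + 2)) (lam i₀ ^ m * z (0 + 2)) := (hsum 0).mul_left _
  simp only [Nat.zero_add] at h2
  refine hasSum_le (fun i => ?_) (hsum m) h2
  rw [pow_add]
  exact mul_le_mul_of_nonneg_right (pow_le_pow_left₀ (hle i).1 (hle i).2 m) (pow_nonneg (hle i).1 2)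

/-- `log z(m+2)/(m+2) → log λ₀`. -/
theorem tendsto_log_div {ι : Type} {lam : ι → ℝ} {i₀ : ι} (hle : ∀ i, 0 ≤ lam i ∧ lam i ≤ lam i₀) (hpos : 0 < lam i₀)
    (hsum : ∀ m : ℕ, HasSum (fun i => lam i ^ (m + 2)) (z (m + 2))) :
    Tendsto (fun m : ℕ => Real.log (z (m + 2)) / ((m : ℝ) + 2)) atTop (𝓝 (Real.log (lam i₀))) := by
  set K : ℝ := Real.log (z 2) - 2 * Real.log (lam i₀) with hK
  have hz2 : 0 < z 2 := (datum_bounds hle hpos hsum 0).2.2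
  have hup : Tendsto (fun m : ℕ => Real.log (lam i₀) + K / ((m : ℝ) + 2)) atTop (𝓝 (Real.log (lam i₀) + 0)) := by
    refine tendsto_const_nhds.add ?_
    refine Tendsto.div_atTop (tendsto_const_nhds) ?_
    exact tendsto_atTop_add_const_right _ _ tendsto_natCast_atTop_atTop
  rw [add_zero] at hup
  refine tendsto_of_tendsto_of_tendsto_of_le_of_le tendsto_const_nhds hup (fun m => ?_) (fun m => ?_)
  · -- lower: (m+2) log λ₀ ≤ log z(m+2)
    obtain ⟨h1, -, hzpos⟩ := datum_bounds hle hpos hsum m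
    have hm : (0 : ℝ) < (m : ℝ) + 2 := by positivity
    rw [le_div_iff₀ hm]
    have := Real.log_le_log (pow_pos hpos _) h1
    rw [Real.log_pow] at this
    push_cast at this
    linarith
  · obtain ⟨-, h2, hzpos⟩ := datum_bounds hle hpos hsum m
    have hm : (0 : ℝ) < (m : ℝ) + 2 := by positivity
    rw [div_le_iff₀ hm, add_mul, div_mul_cancel₀ _ hm.ne']
    have := Real.log_le_log hzpos h2
    rw [Real.log_mul (pow_pos hpos _).ne' hz2.ne', Real.log_pow] at this
    rw [hK]
    linarith

/-- **`φ(z) = log λ₀`** for every spectral datum of `z`. -/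
theorem phi_eq_log {ι : Type} {lam : ι → ℝ} {i₀ : ι} (hle : ∀ i, 0 ≤ lam i ∧ lam i ≤ lam i₀) (hpos : 0 < lam i₀)
    (hsum : ∀ m : ℕ, HasSum (fun i => lam i ^ (m + 2)) (z (m + 2))) : phi z = Real.log (lam i₀) :=
  (tendsto_log_div hle hpos hsum).limUnder_eq

theorem exp_mul_phi {ι : Type} {lam : ι → ℝ} {i₀ : ι} (hle : ∀ i, 0 ≤ lam i ∧ lam i ≤ lam i₀) (hpos : 0 < lam i₀)
    (hsum : ∀ m : ℕ, HasSum (fun i => lam i ^ (m + 2)) (z (m + 2))) (m : ℕ) :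
    Real.exp ((m : ℝ) * phi z) = lam i₀ ^ m := by
  rw [phi_eq_log hle hpos hsum, Real.exp_nat_mul, Real.exp_log hpos]

/-- **Ratios.**  `rᵢ = λᵢ/λ₀ ∈ [0,1]`, `r_{i₀} = 1`, `z > 0`, `Σ rᵢ^{m+2} = z(m+2)/e^{(m+2)φ}`, and the excess is the sum
over `i ≠ i₀`. -/
theorem exists_ratios (h : HasSpectralDatum z) :
    ∃ (ι : Type) (_ : DecidableEq ι) (r : ι → ℝ) (i₀ : ι), (∀ i, 0 ≤ r i ∧ r i ≤ 1) ∧ r i₀ = 1 ∧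
      (∀ m : ℕ, 0 < z (m + 2)) ∧
      (∀ m : ℕ, HasSum (fun i => r i ^ (m + 2)) (z (m + 2) / Real.exp (((m + 2 : ℕ) : ℝ) * phi z))) ∧
      ∀ m : ℕ, HasSum (Function.update (fun i => r i ^ (m + 2)) i₀ 0) (exc z (m + 2)) := by
  classical
  obtain ⟨ι, lam, i₀, hle, hpos, hsum⟩ := h
  have hexp : ∀ m : ℕ, Real.exp (((m + 2 : ℕ) : ℝ) * phi z) = lam i₀ ^ (m + 2) := fun m =>
    exp_mul_phi hle hpos hsum (m + 2)
  refine ⟨ι, inferInstance, fun i => lam i / lam i₀, i₀, fun i => ⟨div_nonneg (hle i).1 hpos.le,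
    (div_le_one hpos).2 (hle i).2⟩, div_self hpos.ne', fun m => (datum_bounds hle hpos hsum m).2.2,
    fun m => ?_, fun m => ?_⟩
  · rw [hexp]
    refine ((hsum m).div_const (lam i₀ ^ (m + 2))).congr_fun fun i => ?_
    rw [div_pow]
  · have h1 : HasSum (fun i => (lam i / lam i₀) ^ (m + 2)) (z (m + 2) / lam i₀ ^ (m + 2)) := by
      refine ((hsum m).div_const (lam i₀ ^ (m + 2))).congr_fun fun i => ?_
      rw [div_pow]
    have h2 := h1.update i₀ 0
    rw [div_self hpos.ne', one_pow] at h2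
    have hx : exc z (m + 2) = 0 - 1 + z (m + 2) / lam i₀ ^ (m + 2) := by
      unfold exc
      rw [hexp m]
      ring
    rw [hx]
    exact h2

/-- `x_{m+2} ≥ 0`. -/
theorem exc_nonneg (h : HasSpectralDatum z) (m : ℕ) : 0 ≤ exc z (m + 2) := by
  obtain ⟨ι, _, r, i₀, hr, -, -, -, hx⟩ := exists_ratios h
  refine (hx m).nonneg fun i => ?_
  rcases eq_or_ne i i₀ with rfl | hne
  · simp
  · rw [Function.update_of_ne hne]; exact pow_nonneg (hr i).1 _

/-- `x` is non-increasing: `x_{k+2} ≤ x_{m+2}` for `m ≤ k`. -/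
theorem exc_antitone (h : HasSpectralDatum z) {m k : ℕ} (hmk : m ≤ k) : exc z (k + 2) ≤ exc z (m + 2) := by
  obtain ⟨ι, _, r, i₀, hr, -, -, -, hx⟩ := exists_ratios h
  refine hasSum_le (fun i => ?_) (hx k) (hx m)
  rcases eq_or_ne i i₀ with rfl | hne
  · simp
  · rw [Function.update_of_ne hne, Function.update_of_ne hne]
    exact pow_le_pow_of_le_one (hr i).1 (hr i).2 (by omega)

/-- `x_{2(m+2)} ≤ x_{m+2}²`. -/
theorem exc_two_mul_le_sq (h : HasSpectralDatum z) (m : ℕ) : exc z (2 * (m + 2)) ≤ exc z (m + 2) ^ 2 := by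
  obtain ⟨ι, _, r, i₀, hr, -, -, -, hx⟩ := exists_ratios h
  have hxm := hx m
  have hx2 : HasSum (Function.update (fun i => r i ^ (2 * m + 2 + 2)) i₀ 0) (exc z (2 * (m + 2))) := by
    have := hx (2 * m + 2)
    rwa [show 2 * m + 2 + 2 = 2 * (m + 2) from by ring] at this
  have hg0 : ∀ i, 0 ≤ Function.update (fun i => r i ^ (m + 2)) i₀ 0 i := fun i => by
    rcases eq_or_ne i i₀ with rfl | hne
    · simp
    · rw [Function.update_of_ne hne]; exact pow_nonneg (hr i).1 _
  have hterm : ∀ i, i ≠ i₀ → r i ^ (m + 2) ≤ exc z (m + 2) := fun i hne => by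
    have := le_hasSum hxm i fun j _ => hg0 j
    rwa [Function.update_of_ne hne] at this
  have hcmp : ∀ i, Function.update (fun i => r i ^ (2 * m + 2 + 2)) i₀ 0 i ≤
      exc z (m + 2) * Function.update (fun i => r i ^ (m + 2)) i₀ 0 i := fun i => by
    rcases eq_or_ne i i₀ with rfl | hne
    · simp
    · rw [Function.update_of_ne hne, Function.update_of_ne hne,
        show 2 * m + 2 + 2 = (m + 2) + (m + 2) from by ring, pow_add]
      exact mul_le_mul_of_nonneg_right (hterm i hne) (pow_nonneg (hr i).1 _)
  have := hasSum_le hcmp hx2 (hxm.mul_left (exc z (m + 2)))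
  rw [sq]; exact this

/-- `z(m+2) = e^{(m+2)φ} (1 + x_{m+2})`. -/
theorem z_eq_exp_mul (h : HasSpectralDatum z) (m : ℕ) :
    z (m + 2) = Real.exp (((m + 2 : ℕ) : ℝ) * phi z) * (1 + exc z (m + 2)) := by
  unfold exc
  have hE : 0 < Real.exp (((m + 2 : ℕ) : ℝ) * phi z) := Real.exp_pos _
  field_simp
  push_cast
  ring

/-- `log z(m+2) = (m+2) φ + log(1 + x_{m+2})`, i.e. `Y_{m+2} = log(1 + x_{m+2})`. -/
theorem Yfun_eq_log (h : HasSpectralDatum z) (m : ℕ) : Yfun z (m + 2) = Real.log (1 + exc z (m + 2)) := by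
  unfold Yfun
  have hx := exc_nonneg h m
  rw [z_eq_exp_mul h m, Real.log_mul (Real.exp_pos _).ne' (by linarith), Real.log_exp]
  push_cast
  ring

theorem Yfun_nonneg (h : HasSpectralDatum z) (m : ℕ) : 0 ≤ Yfun z (m + 2) := by
  rw [Yfun_eq_log h m]; exact Real.log_nonneg (by linarith [exc_nonneg h m])

theorem Yfun_antitone (h : HasSpectralDatum z) {m k : ℕ} (hmk : m ≤ k) : Yfun z (k + 2) ≤ Yfun z (m + 2) := by
  rw [Yfun_eq_log h m, Yfun_eq_log h k]
  exact Real.log_le_log (by linarith [exc_nonneg h k]) (by linarith [exc_antitone h hmk])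

theorem Yfun_le_exc (h : HasSpectralDatum z) (m : ℕ) : Yfun z (m + 2) ≤ exc z (m + 2) := by
  rw [Yfun_eq_log h m]
  have hx := exc_nonneg h m
  have := Real.add_one_le_exp (Real.log (1 + exc z (m + 2)))
  rw [Real.exp_log (by linarith)] at this
  linarith

theorem exc_eq_exp_Yfun (h : HasSpectralDatum z) (m : ℕ) : exc z (m + 2) = Real.exp (Yfun z (m + 2)) - 1 := by
  rw [Yfun_eq_log h m, Real.exp_log (by linarith [exc_nonneg h m])]; ring

/-- sandwich, lower half: `(m+2) φ ≤ log z(m+2)`. -/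
theorem mul_phi_le_log (h : HasSpectralDatum z) (m : ℕ) : ((m + 2 : ℕ) : ℝ) * phi z ≤ Real.log (z (m + 2)) := by
  have := Yfun_nonneg h m
  unfold Yfun at this
  linarith

/-- sandwich, upper half: `log z(m+2) ≤ (m+2) φ + Y_2`. -/
theorem log_le_mul_phi_add (h : HasSpectralDatum z) (m : ℕ) :
    Real.log (z (m + 2)) ≤ ((m + 2 : ℕ) : ℝ) * phi z + Yfun z 2 := by
  have := Yfun_antitone h (Nat.zero_le m)
  unfold Yfun at this ⊢
  push_cast at this ⊢
  linarith

theorem z_pos (h : HasSpectralDatum z) (m : ℕ) : 0 < z (m + 2) := by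
  obtain ⟨ι, _, r, i₀, -, -, hz, -, -⟩ := exists_ratios h
  exact hz m

/-- **ℓᵖ-monotonicity of the spectrum**: `z(n')^n ≤ z(n)^{n'}` for `2 ≤ n ≤ n'` (i.e. `‖λ‖_{n'} ≤ ‖λ‖_n`). -/
theorem pow_le_pow_of_le (h : HasSpectralDatum z) {a a' : ℕ} (haa' : a ≤ a') :
    z (a' + 2) ^ (a + 2) ≤ z (a + 2) ^ (a' + 2) := by
  obtain ⟨ι, lam, i₀, hle, hpos, hsum⟩ := h
  set S : ℝ := z (a + 2) with hS
  have hSpos : 0 < S := (datum_bounds hle hpos hsum a).2.2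
  set ν : ℝ := S ^ (((a + 2 : ℕ) : ℝ)⁻¹) with hν
  have hνpos : 0 < ν := Real.rpow_pos_of_pos hSpos _
  have hνpow : ν ^ (a + 2) = S := by
    rw [hν]
    exact Real.rpow_inv_natCast_pow hSpos.le (by omega)
  have hli : ∀ i, lam i ≤ ν := fun i => by
    have h1 : lam i ^ (a + 2) ≤ S := le_hasSum (hsum a) i fun j _ => pow_nonneg (hle j).1 _
    rw [← hνpow] at h1
    exact (pow_le_pow_iff_left₀ (hle i).1 hνpos.le (by omega)).1 h1
  have hcmp : ∀ i, lam i ^ (a' + 2) ≤ ν ^ (a' - a) * lam i ^ (a + 2) := fun i => by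
    rw [show a' + 2 = (a' - a) + (a + 2) from by omega, pow_add]
    exact mul_le_mul_of_nonneg_right (pow_le_pow_left₀ (hle i).1 (hli i) _) (pow_nonneg (hle i).1 _)
  have hsum' : z (a' + 2) ≤ ν ^ (a' - a) * S := hasSum_le hcmp (hsum a') ((hsum a).mul_left _)
  have hz' : 0 ≤ z (a' + 2) := (datum_bounds hle hpos hsum a').2.2.le
  calc z (a' + 2) ^ (a + 2) ≤ (ν ^ (a' - a) * S) ^ (a + 2) := pow_le_pow_left₀ hz' hsum' _
    _ = (ν ^ (a + 2)) ^ (a' + 2) := by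
        rw [← hνpow, ← pow_add, ← pow_mul, ← pow_mul]; congr 1
        rw [show a' - a + (a + 2) = a' + 2 from by omega, mul_comm]
    _ = S ^ (a' + 2) := by rw [hνpow]

/-- log form: `n log z(n') ≤ n' log z(n)` for `2 ≤ n ≤ n'`. -/
theorem mul_log_le (h : HasSpectralDatum z) {a a' : ℕ} (haa' : a ≤ a') :
    ((a + 2 : ℕ) : ℝ) * Real.log (z (a' + 2)) ≤ ((a' + 2 : ℕ) : ℝ) * Real.log (z (a + 2)) := by
  have h1 := Real.log_le_log (pow_pos (z_pos h a') _) (pow_le_pow_of_le h haa')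
  rwa [Real.log_pow, Real.log_pow] at h1

/-- doubling: `z(2n) ≤ z(n)²`, `n ≥ 2`. -/
theorem z_two_mul_le_sq (h : HasSpectralDatum z) (m : ℕ) : z (2 * (m + 2)) ≤ z (m + 2) ^ 2 := by
  have h1 := pow_le_pow_of_le h (show m ≤ 2 * m + 2 by omega)
  rw [show 2 * m + 2 + 2 = 2 * (m + 2) from by ring] at h1
  rw [show z (m + 2) ^ (2 * (m + 2)) = (z (m + 2) ^ 2) ^ (m + 2) from by rw [← pow_mul]] at h1
  have hz : 0 ≤ z (2 * (m + 2)) := by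
    rw [show 2 * (m + 2) = (2 * m + 2) + 2 from by ring]; exact (z_pos h _).le
  exact (pow_le_pow_iff_left₀ hz (sq_nonneg _) (by omega : m + 2 ≠ 0)).1 h1

/-- The period-doubling defect of one box in terms of the excess: `0 ≤ δ ≤ 1`, `δ ≤ 2 x_t`, and
`δ ≤ η ≤ 1/2 ⇒ x_t ≤ 2η`. -/
theorem defect_facts (h : HasSpectralDatum z) (m : ℕ) :
    0 ≤ 1 - z (2 * (m + 2)) / z (m + 2) ^ 2 ∧ 1 - z (2 * (m + 2)) / z (m + 2) ^ 2 ≤ 1 ∧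
      1 - z (2 * (m + 2)) / z (m + 2) ^ 2 ≤ 2 * exc z (m + 2) ∧
      ∀ η : ℝ, η ≤ 1 / 2 → 1 - z (2 * (m + 2)) / z (m + 2) ^ 2 ≤ η → exc z (m + 2) ≤ 2 * η := by
  have hz1 : 0 < z (m + 2) := z_pos h m
  have hz2 : 0 < z (2 * (m + 2)) := by
    rw [show 2 * (m + 2) = (2 * m + 2) + 2 from by ring]; exact z_pos h _
  have hx1 := exc_nonneg h m
  have hx2 : 0 ≤ exc z (2 * (m + 2)) := by
    rw [show 2 * (m + 2) = (2 * m + 2) + 2 from by ring]; exact exc_nonneg h _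
  have hx21 : exc z (2 * (m + 2)) ≤ exc z (m + 2) := by
    rw [show 2 * (m + 2) = (2 * m + 2) + 2 from by ring]; exact exc_antitone h (by omega)
  -- the ratio in terms of the excess
  have e1 := z_eq_exp_mul h m
  have e2 : z (2 * (m + 2)) = Real.exp (((2 * (m + 2) : ℕ) : ℝ) * phi z) * (1 + exc z (2 * (m + 2))) := by
    have := z_eq_exp_mul h (2 * m + 2)
    rwa [show 2 * m + 2 + 2 = 2 * (m + 2) from by ring] at this
  have e3 : Real.exp (((2 * (m + 2) : ℕ) : ℝ) * phi z) = Real.exp (((m + 2 : ℕ) : ℝ) * phi z) ^ 2 := by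
    rw [← Real.exp_nat_mul]; push_cast; ring_nf
  have hE : 0 < Real.exp (((m + 2 : ℕ) : ℝ) * phi z) := Real.exp_pos _
  set x : ℝ := exc z (m + 2) with hxdef
  set x2 : ℝ := exc z (2 * (m + 2)) with hx2def
  have hx0 : (1 + x) ≠ 0 := ne_of_gt (by linarith)
  have hratio : z (2 * (m + 2)) / z (m + 2) ^ 2 = (1 + x2) / (1 + x) ^ 2 := by
    rw [e2, e3, e1]
    field_simp
  refine ⟨?_, ?_, ?_, fun η hη hδ => ?_⟩
  · rw [sub_nonneg, div_le_one (pow_pos hz1 2)]; exact z_two_mul_le_sq h m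
  · have : 0 ≤ z (2 * (m + 2)) / z (m + 2) ^ 2 := div_nonneg hz2.le (sq_nonneg _)
    linarith
  · rw [hratio]
    have h1 : 1 / (1 + x) ^ 2 ≤ (1 + x2) / (1 + x) ^ 2 :=
      div_le_div_of_nonneg_right (by linarith) (sq_nonneg _)
    have h2 : 1 - 2 * x ≤ 1 / (1 + x) ^ 2 := by
      rw [le_div_iff₀ (by positivity)]
      nlinarith [mul_nonneg hx1 hx1, mul_nonneg (mul_nonneg hx1 hx1) hx1]
    linarith
  · rw [hratio] at hδ
    have h1 : (1 + x2) / (1 + x) ^ 2 ≤ (1 + x) / (1 + x) ^ 2 :=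
      div_le_div_of_nonneg_right (by linarith) (sq_nonneg _)
    have h2 : (1 + x) / (1 + x) ^ 2 = 1 / (1 + x) := by
      field_simp
    rw [h2] at h1
    have h3 : 1 - η ≤ 1 / (1 + x) := by linarith
    rw [le_div_iff₀ (by positivity)] at h3
    nlinarith


/-- a lower volume bound on `log z` forces `φ ≥ −c`. -/
theorem phi_ge_of_lower (h : HasSpectralDatum z) (c : ℝ)
    (hlow : ∀ m : ℕ, -(c * ((m + 2 : ℕ) : ℝ)) ≤ Real.log (z (m + 2))) : -c ≤ phi z := by
  have hK := Yfun_nonneg h 0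
  have key : ∀ m : ℕ, -c ≤ phi z + Yfun z 2 / ((m : ℝ) + 2) := fun m => by
    have h1 := log_le_mul_phi_add h m
    have h2 := hlow m
    have hm : (0:ℝ) < (m:ℝ) + 2 := by positivity
    have e : ((m + 2 : ℕ) : ℝ) = (m : ℝ) + 2 := by push_cast; ring
    rw [e] at h1 h2
    rw [show phi z + Yfun z 2 / ((m:ℝ) + 2) = (phi z * ((m:ℝ) + 2) + Yfun z 2) / ((m:ℝ) + 2) from by
      field_simp, le_div_iff₀ hm]
    linarith
  have hlim : Tendsto (fun m : ℕ => phi z + Yfun z 2 / ((m : ℝ) + 2)) atTop (𝓝 (phi z + 0)) :=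
    tendsto_const_nhds.add (Tendsto.div_atTop tendsto_const_nhds
      (tendsto_atTop_add_const_right _ _ tendsto_natCast_atTop_atTop))
  rw [add_zero] at hlim
  exact le_of_tendsto_of_tendsto' tendsto_const_nhds hlim key

/-- termwise Casimir inequality in the transposed channel: `q log w(n) − log w(n') ≤ q Y_c(w)` for `c ≤ n`, `q n = n'`. -/
theorem termwise (h : HasSpectralDatum z) {kc kn kn' : ℕ} (hck : kc ≤ kn) (q : ℝ) (hq : 0 ≤ q)
    (hqn : q * ((kn + 2 : ℕ) : ℝ) = ((kn' + 2 : ℕ) : ℝ)) :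
    q * Real.log (z (kn + 2)) - Real.log (z (kn' + 2)) ≤ q * Yfun z (kc + 2) := by
  have e : Real.log (z (kn + 2)) = ((kn + 2 : ℕ) : ℝ) * phi z + Yfun z (kn + 2) := by unfold Yfun; ring
  have hY : q * Yfun z (kn + 2) ≤ q * Yfun z (kc + 2) := mul_le_mul_of_nonneg_left (Yfun_antitone h hck) hq
  have low := mul_phi_le_log h kn'
  have h1 : q * Real.log (z (kn + 2)) = q * ((kn + 2 : ℕ) : ℝ) * phi z + q * Yfun z (kn + 2) := by
    rw [e]; ring
  rw [hqn] at h1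
  linarith

/-- `e^v − 1 ≤ v e^v` for `v ≥ 0`. -/
theorem exp_sub_one_le {v : ℝ} (hv : 0 ≤ v) : Real.exp v - 1 ≤ v * Real.exp v := by
  have h1 := Real.add_one_le_exp (-v)
  have hE := Real.exp_pos v
  rw [Real.exp_neg] at h1
  have h2 := mul_le_mul_of_nonneg_right h1 hE.le
  rw [inv_mul_cancel₀ hE.ne'] at h2
  nlinarith

end OneBox

/-! ## §1c The bootstrap over an axis-symmetric trace-positive family -/

/-- [Sym] The three transpositions of the arguments of `Z : ℕ⁴ → ℝ` used by the bootstrap: `(0 3)` (read the first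
side as Euclidean time), `(0 1)` and `(0 2)` (move the short spatial side to slot 0).  They generate `S₄`. -/
def IsAxisSymmetric (Z : ℕ → ℕ → ℕ → ℕ → ℝ) : Prop :=
  ∀ a b c d : ℕ, Z a b c d = Z d b c a ∧ Z a b c d = Z b a c d ∧ Z a b c d = Z c b a d

/-- [TM-aniso] Every spatial box `(b₁,b₂,b₃)` with sides `≥ 2` has a spectral datum for the time direction (slot 3). -/
def IsTracePositive (Z : ℕ → ℕ → ℕ → ℕ → ℝ) : Prop :=
  ∀ b₁ b₂ b₃ : ℕ, 2 ≤ b₁ → 2 ≤ b₂ → 2 ≤ b₃ → HasSpectralDatum (Z b₁ b₂ b₃)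

/-- [Vol] Stability bounds `e^{−A·n₀n₁n₂n₃} ≤ Z ≤ 1` (sides `≥ 2`; for Wilson's action at `β ≥ 0`:
`0 ≤ n − Re tr ρ(U_p) ≤ 2n` on each of the `6·n₀n₁n₂n₃` plaquettes, `A = 12 n β`). -/
def HasVolumeBounds (Z : ℕ → ℕ → ℕ → ℕ → ℝ) : Prop :=
  ∃ A : ℝ, ∀ a b c d : ℕ, 2 ≤ a → 2 ≤ b → 2 ≤ c → 2 ≤ d →
    Real.exp (-(A * ((a * b * c * d : ℕ) : ℝ))) ≤ Z a b c d ∧ Z a b c d ≤ 1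

/-- The cold defect of an abstract family: `1 − Z(L,L,L,2⌊L/4⌋)/Z(L,L,L,⌊L/4⌋)²` (`coldDefect` is this, by `rfl`). -/
def boxDefect (Z : ℕ → ℕ → ℕ → ℕ → ℝ) (L : ℕ) : ℝ :=
  1 - Z L L L (2 * (L / 4)) / Z L L L (L / 4) ^ 2

/-- The universal (β-free, model-free) squaring constant `2·432²·e^{432}` produced by the bootstrap (not optimised;
the exact 2D-Ising data show `δ(2L)/δ(L)² ≤ 1.1`). -/
def squaringConst : ℝ := 2 * 432 ^ 2 * Real.exp 432

section Family

variable {Z : ℕ → ℕ → ℕ → ℕ → ℝ}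

/-- **Casimir slope ≤ slab pressure** (step (2)): for `2 ≤ τ`, `2 ≤ c ≤ n ≤ n'`,
`τ ((n'/n) φ(n,b₁,b₂) − φ(n',b₁,b₂)) ≤ (n'/n) Y_c(τ,b₁,b₂) + Y_2(n',b₁,b₂)`. -/
theorem slope_bound (hS : IsAxisSymmetric Z) (hT : IsTracePositive Z) {b₁ b₂ τ c n n' : ℕ}
    (hb₁ : 2 ≤ b₁) (hb₂ : 2 ≤ b₂) (hτ : 2 ≤ τ) (hc : 2 ≤ c) (hcn : c ≤ n) (hnn' : n ≤ n') :
    (τ : ℝ) * (((n' : ℝ) / n) * phi (Z n b₁ b₂) - phi (Z n' b₁ b₂)) ≤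
      ((n' : ℝ) / n) * Yfun (Z τ b₁ b₂) c + Yfun (Z n' b₁ b₂) 2 := by
  obtain ⟨kτ, rfl⟩ : ∃ kτ, τ = kτ + 2 := ⟨τ - 2, by omega⟩
  obtain ⟨kc, rfl⟩ : ∃ kc, c = kc + 2 := ⟨c - 2, by omega⟩
  obtain ⟨kn, rfl⟩ : ∃ kn, n = kn + 2 := ⟨n - 2, by omega⟩
  obtain ⟨kn', rfl⟩ : ∃ kn', n' = kn' + 2 := ⟨n' - 2, by omega⟩
  have hdn : HasSpectralDatum (Z (kn + 2) b₁ b₂) := hT _ _ _ (by omega) hb₁ hb₂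
  have hdn' : HasSpectralDatum (Z (kn' + 2) b₁ b₂) := hT _ _ _ (by omega) hb₁ hb₂
  have hdτ : HasSpectralDatum (Z (kτ + 2) b₁ b₂) := hT _ _ _ (by omega) hb₁ hb₂
  have A1 := mul_phi_le_log hdn kτ
  have A2 := log_le_mul_phi_add hdn' kτ
  have A3 : Z (kn + 2) b₁ b₂ (kτ + 2) = Z (kτ + 2) b₁ b₂ (kn + 2) := (hS _ _ _ _).1
  have A3' : Z (kn' + 2) b₁ b₂ (kτ + 2) = Z (kτ + 2) b₁ b₂ (kn' + 2) := (hS _ _ _ _).1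
  have hnpos : (0 : ℝ) < ((kn + 2 : ℕ) : ℝ) := by positivity
  have hq : 0 ≤ ((kn' + 2 : ℕ) : ℝ) / ((kn + 2 : ℕ) : ℝ) := by positivity
  have hqn : ((kn' + 2 : ℕ) : ℝ) / ((kn + 2 : ℕ) : ℝ) * ((kn + 2 : ℕ) : ℝ) = ((kn' + 2 : ℕ) : ℝ) :=
    div_mul_cancel₀ _ hnpos.ne'
  have A4 := termwise hdτ (show kc ≤ kn by omega) _ hq hqn
  rw [← A3, ← A3'] at A4
  have A1' := mul_le_mul_of_nonneg_left A1 hq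
  -- assemble
  have e : ((kτ + 2 : ℕ) : ℝ) * (((kn' + 2 : ℕ) : ℝ) / ((kn + 2 : ℕ) : ℝ) * phi (Z (kn + 2) b₁ b₂)) =
      ((kn' + 2 : ℕ) : ℝ) / ((kn + 2 : ℕ) : ℝ) * (((kτ + 2 : ℕ) : ℝ) * phi (Z (kn + 2) b₁ b₂)) := by ring
  push_cast at e A1' A2 A4 ⊢
  nlinarith [e, A1', A2, A4]

/-- **Side extension in the transposed channel** (step (1)): for `0 < c`, `2 ≤ n ≤ n'`,
`Y_c(n',b₁,b₂) ≤ (n'/n) Y_c(n,b₁,b₂) + c ((n'/n) φ(n,b₁,b₂) − φ(n',b₁,b₂))`. -/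
theorem extension_step (hS : IsAxisSymmetric Z) (hT : IsTracePositive Z) {b₁ b₂ c n n' : ℕ}
    (hb₁ : 2 ≤ b₁) (hb₂ : 2 ≤ b₂) (hc : 2 ≤ c) (hn : 2 ≤ n) (hnn' : n ≤ n') :
    Yfun (Z n' b₁ b₂) c ≤ ((n' : ℝ) / n) * Yfun (Z n b₁ b₂) c +
      (c : ℝ) * (((n' : ℝ) / n) * phi (Z n b₁ b₂) - phi (Z n' b₁ b₂)) := by
  obtain ⟨kn, rfl⟩ : ∃ kn, n = kn + 2 := ⟨n - 2, by omega⟩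
  obtain ⟨kn', rfl⟩ : ∃ kn', n' = kn' + 2 := ⟨n' - 2, by omega⟩
  have hw : HasSpectralDatum (Z c b₁ b₂) := hT _ _ _ hc hb₁ hb₂
  have h1 := mul_log_le hw (show kn ≤ kn' by omega)
  have A3 : Z (kn + 2) b₁ b₂ c = Z c b₁ b₂ (kn + 2) := (hS _ _ _ _).1
  have A3' : Z (kn' + 2) b₁ b₂ c = Z c b₁ b₂ (kn' + 2) := (hS _ _ _ _).1
  rw [← A3, ← A3'] at h1
  have hnpos : (0 : ℝ) < ((kn + 2 : ℕ) : ℝ) := by positivity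
  have key : Real.log (Z (kn' + 2) b₁ b₂ c) ≤
      ((kn' + 2 : ℕ) : ℝ) / ((kn + 2 : ℕ) : ℝ) * Real.log (Z (kn + 2) b₁ b₂ c) := by
    rw [div_mul_eq_mul_div, le_div_iff₀ hnpos]
    linarith
  unfold Yfun
  have e : ((kn' + 2 : ℕ) : ℝ) / ((kn + 2 : ℕ) : ℝ) * (Real.log (Z (kn + 2) b₁ b₂ c) - (c : ℝ) * phi (Z (kn + 2) b₁ b₂)) +
      (c : ℝ) * (((kn' + 2 : ℕ) : ℝ) / ((kn + 2 : ℕ) : ℝ) * phi (Z (kn + 2) b₁ b₂) - phi (Z (kn' + 2) b₁ b₂)) =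
      ((kn' + 2 : ℕ) : ℝ) / ((kn + 2 : ℕ) : ℝ) * Real.log (Z (kn + 2) b₁ b₂ c) - (c : ℝ) * phi (Z (kn' + 2) b₁ b₂) := by
    ring
  rw [e]
  linarith

/-- **The closed extension inequality** (steps (1)–(3)): for `L ≥ 8`, `t = ⌊L/4⌋`, `L ≤ L'` and any cross-section
`(b₁,b₂)`: `Y_t(L',b₁,b₂) ≤ (3/2)(L'/L) Y_t(L,b₁,b₂)` — the Casimir slope is bounded by the slab pressure of the SAME
cross-section, and the slab-pressure tower closes on the box of length `L` itself because `2t/L ≤ 1/2 < 1`. -/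
theorem extension_le (hS : IsAxisSymmetric Z) (hT : IsTracePositive Z) (hV : HasVolumeBounds Z)
    {b₁ b₂ L L' : ℕ} (hb₁ : 2 ≤ b₁) (hb₂ : 2 ≤ b₂) (hL : 8 ≤ L) (hLL' : L ≤ L') :
    Yfun (Z L' b₁ b₂) (L / 4) ≤ 3 / 2 * ((L' : ℝ) / L) * Yfun (Z L b₁ b₂) (L / 4) := by
  obtain ⟨k, hk⟩ : ∃ k, L / 4 = k + 2 := ⟨L / 4 - 2, by omega⟩
  rw [hk]
  obtain ⟨A, hA⟩ := hV
  have hLpos : 0 < L := by omega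
  have hLr : (0 : ℝ) < L := by exact_mod_cast hLpos
  have hL0 : (L : ℝ) ≠ 0 := hLr.ne'
  have ht4 : 4 * (k + 2) ≤ L := by omega
  have hθ : ((k + 2 : ℕ) : ℝ) / L ≤ 1 / 4 := by
    rw [div_le_iff₀ hLr]
    have : ((4 * (k + 2) : ℕ) : ℝ) ≤ L := by exact_mod_cast ht4
    push_cast at this ⊢
    linarith
  -- the dyadic tower `D_i = 2^i L`
  have hD : ∀ i : ℕ, 0 < 2 ^ i * L := fun i => by positivity
  have hD2 : ∀ i : ℕ, 2 ≤ 2 ^ i * L := fun i =>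
    le_trans (by omega) (Nat.mul_le_mul_right L (Nat.one_le_two_pow))
  have hDc : ∀ i : ℕ, k + 2 ≤ 2 ^ i * L := fun i =>
    le_trans (by omega) (Nat.mul_le_mul_right L (Nat.one_le_two_pow))
  have hDD : ∀ j : ℕ, 2 ^ j * L ≤ 2 ^ (j + 1) * L := fun j =>
    Nat.mul_le_mul_right L (Nat.pow_le_pow_right (by norm_num) (by omega))
  have hDr : ∀ i : ℕ, ((2 ^ i * L : ℕ) : ℝ) = (2 : ℝ) ^ i * L := fun i => by push_cast; ring
  have hDr0 : ∀ i : ℕ, (0 : ℝ) < (2 : ℝ) ^ i * L := fun i => by positivity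
  have hr : ∀ j : ℕ, ((2 ^ (j + 1) * L : ℕ) : ℝ) / ((2 ^ j * L : ℕ) : ℝ) = 2 := fun j => by
    rw [hDr, hDr, pow_succ]
    field_simp
  set a : ℕ → ℝ := fun i => Yfun (Z (2 ^ i * L) b₁ b₂) (k + 2) / ((2 : ℝ) ^ i * L) with ha_def
  have hai : ∀ i, Yfun (Z (2 ^ i * L) b₁ b₂) (k + 2) = a i * ((2 : ℝ) ^ i * L) := fun i => by
    rw [ha_def]; dsimp only; rw [div_mul_cancel₀ _ (hDr0 i).ne']
  -- (P3) a priori bounds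
  have ha0 : ∀ i, 0 ≤ a i := fun i =>
    div_nonneg (Yfun_nonneg (hT _ _ _ (hD2 i) hb₁ hb₂) k) (hDr0 i).le
  have hphi_ge : ∀ D : ℕ, 2 ≤ D → -(A * D * b₁ * b₂) ≤ phi (Z D b₁ b₂) := fun D hDpos => by
    have hd := hT D b₁ b₂ hDpos hb₁ hb₂
    refine phi_ge_of_lower hd (A * D * b₁ * b₂) fun m => ?_
    have h1 := (hA D b₁ b₂ (m + 2) hDpos hb₁ hb₂ (by omega)).1
    have h2 := Real.log_le_log (Real.exp_pos _) h1
    rw [Real.log_exp] at h2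
    have e : (A * ((D * b₁ * b₂ * (m + 2) : ℕ) : ℝ)) = A * D * b₁ * b₂ * ((m + 2 : ℕ) : ℝ) := by
      push_cast; ring
    linarith
  have haA : ∀ i, a i ≤ 2 * A * b₁ * b₂ := fun i => by
    have hd := hT _ _ _ (hD2 i) hb₁ hb₂
    have h1 : Yfun (Z (2 ^ i * L) b₁ b₂) (k + 2) ≤ Yfun (Z (2 ^ i * L) b₁ b₂) (0 + 2) :=
      Yfun_antitone hd (Nat.zero_le k)
    have h2 : Real.log (Z (2 ^ i * L) b₁ b₂ 2) ≤ 0 :=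
      Real.log_nonpos (z_pos hd 0).le ((hA _ _ _ 2 (hD2 i) hb₁ hb₂ le_rfl).2)
    have h3 := hphi_ge (2 ^ i * L) (hD2 i)
    rw [hDr i] at h3
    rw [ha_def]; dsimp only
    rw [div_le_iff₀ (hDr0 i)]
    unfold Yfun at h1 ⊢
    simp only [Nat.zero_add, Nat.cast_ofNat] at h1
    nlinarith
  have hbdd : BddAbove (Set.range a) := ⟨2 * A * b₁ * b₂, by rintro _ ⟨i, rfl⟩; exact haA i⟩
  set M : ℝ := ⨆ i, a i with hM_def
  have hleM : ∀ i, a i ≤ M := fun i => le_ciSup hbdd i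
  have hM0 : 0 ≤ M := (ha0 0).trans (hleM 0)
  -- limit tool: `c + K/(2^i L) → c`
  have hlim : ∀ K c : ℝ, Tendsto (fun i : ℕ => c + K / ((2 : ℝ) ^ i * L)) atTop (𝓝 c) := fun K c => by
    have h1 : Tendsto (fun i : ℕ => ((1 : ℝ) / 2) ^ i) atTop (𝓝 0) :=
      tendsto_pow_atTop_nhds_zero_of_lt_one (by norm_num) (by norm_num)
    have h2 := (h1.const_mul (K / L)).const_add c
    simp only [mul_zero, add_zero] at h2
    refine h2.congr' (Eventually.of_forall fun i => ?_)
    rw [one_div_pow]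
    field_simp
  -- (P2) every doubling slope of the tower is ≤ 2M
  have hslope : ∀ j, 2 * phi (Z (2 ^ j * L) b₁ b₂) - phi (Z (2 ^ (j + 1) * L) b₁ b₂) ≤ 2 * M := fun j => by
    have key : ∀ i, 2 * phi (Z (2 ^ j * L) b₁ b₂) - phi (Z (2 ^ (j + 1) * L) b₁ b₂) ≤
        2 * M + Yfun (Z (2 ^ (j + 1) * L) b₁ b₂) 2 / ((2 : ℝ) ^ i * L) := fun i => by
      have h := slope_bound hS hT hb₁ hb₂ (hD2 i) (show 2 ≤ k + 2 by omega) (hDc j) (hDD j)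
      rw [hr j, hDr i, hai i] at h
      have h' := mul_le_mul_of_nonneg_right (hleM i) (hDr0 i).le
      rw [show 2 * M + Yfun (Z (2 ^ (j + 1) * L) b₁ b₂) 2 / ((2 : ℝ) ^ i * L) =
        (2 * M * ((2 : ℝ) ^ i * L) + Yfun (Z (2 ^ (j + 1) * L) b₁ b₂) 2) / ((2 : ℝ) ^ i * L) from by
          field_simp, le_div_iff₀ (hDr0 i)]
      nlinarith
    exact le_of_tendsto_of_tendsto' tendsto_const_nhds (hlim _ _) key
  -- (P1) + (P2): the slab pressures of the tower stay below `a 0 + θ M`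
  have hP1 : ∀ j, a (j + 1) ≤ a j + ((k + 2 : ℕ) : ℝ) * (2 * M) / ((2 : ℝ) ^ (j + 1) * L) := fun j => by
    have h := extension_step hS hT hb₁ hb₂ (show 2 ≤ k + 2 by omega) (hD2 j) (hDD j)
    rw [hr j, hai j, hai (j + 1)] at h
    have hs := mul_le_mul_of_nonneg_left (hslope j) (show (0 : ℝ) ≤ ((k + 2 : ℕ) : ℝ) by positivity)
    rw [show a j + ((k + 2 : ℕ) : ℝ) * (2 * M) / ((2 : ℝ) ^ (j + 1) * L) =
      (a j * ((2 : ℝ) ^ (j + 1) * L) + ((k + 2 : ℕ) : ℝ) * (2 * M)) / ((2 : ℝ) ^ (j + 1) * L) from by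
        field_simp, le_div_iff₀ (hDr0 (j + 1))]
    have e2 : (2 : ℝ) ^ (j + 1) = 2 * 2 ^ j := by ring
    rw [e2] at h ⊢
    nlinarith
  have hθM : ∀ i, a i ≤ a 0 + ((k + 2 : ℕ) : ℝ) / L * (2 * M) := by
    have main : ∀ i, a i ≤ a 0 + ((k + 2 : ℕ) : ℝ) / L * (2 * M) * (1 - 1 / (2 : ℝ) ^ i) := by
      intro i
      induction i with
      | zero => simp
      | succ i ih =>
        have h1 := hP1 i
        have h2i : (0 : ℝ) < (2 : ℝ) ^ i := by positivity
        have e : ((k + 2 : ℕ) : ℝ) * (2 * M) / ((2 : ℝ) ^ (i + 1) * L) =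
            ((k + 2 : ℕ) : ℝ) / L * (2 * M) * (1 / (2 : ℝ) ^ i - 1 / (2 : ℝ) ^ (i + 1)) := by
          rw [pow_succ]
          field_simp
          ring
        rw [e] at h1
        have e' : a 0 + ((k + 2 : ℕ) : ℝ) / L * (2 * M) * (1 - 1 / (2 : ℝ) ^ i) +
            ((k + 2 : ℕ) : ℝ) / L * (2 * M) * (1 / (2 : ℝ) ^ i - 1 / (2 : ℝ) ^ (i + 1)) =
            a 0 + ((k + 2 : ℕ) : ℝ) / L * (2 * M) * (1 - 1 / (2 : ℝ) ^ (i + 1)) := by ring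
        linarith
    intro i
    have h1 := main i
    have h2 : 0 ≤ ((k + 2 : ℕ) : ℝ) / L * (2 * M) * (1 / (2 : ℝ) ^ i) := by positivity
    nlinarith
  -- (3) CLOSURE: `M ≤ a 0 + θ M`, `θ ≤ 1/2`, hence `M ≤ 2 a 0`
  have hMle : M ≤ 2 * a 0 := by
    have h1 : M ≤ a 0 + ((k + 2 : ℕ) : ℝ) / L * (2 * M) := ciSup_le hθM
    have h2 : ((k + 2 : ℕ) : ℝ) / L * (2 * M) ≤ 1 / 4 * (2 * M) :=
      mul_le_mul_of_nonneg_right hθ (by linarith)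
    linarith
  -- the Casimir slope of `L → L'` is ≤ (L'/L) M
  have hL'pos : 0 < L' := by omega
  set q : ℝ := (L' : ℝ) / L with hq_def
  have hq0 : 0 ≤ q := by positivity
  have hsl : q * phi (Z L b₁ b₂) - phi (Z L' b₁ b₂) ≤ q * M := by
    have key : ∀ i, q * phi (Z L b₁ b₂) - phi (Z L' b₁ b₂) ≤
        q * M + Yfun (Z L' b₁ b₂) 2 / ((2 : ℝ) ^ i * L) := fun i => by
      have h := slope_bound hS hT hb₁ hb₂ (hD2 i) (show 2 ≤ k + 2 by omega) (show k + 2 ≤ L by omega) hLL'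
      rw [hDr i, hai i] at h
      have h' := mul_le_mul_of_nonneg_left (mul_le_mul_of_nonneg_right (hleM i) (hDr0 i).le) hq0
      rw [show q * M + Yfun (Z L' b₁ b₂) 2 / ((2 : ℝ) ^ i * L) =
        (q * M * ((2 : ℝ) ^ i * L) + Yfun (Z L' b₁ b₂) 2) / ((2 : ℝ) ^ i * L) from by
          field_simp, le_div_iff₀ (hDr0 i)]
      nlinarith
    exact le_of_tendsto_of_tendsto' tendsto_const_nhds (hlim _ _) key
  -- (P5) the extension inequality
  have h5 := extension_step hS hT hb₁ hb₂ (show 2 ≤ k + 2 by omega) (show 2 ≤ L by omega) hLL'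
  have ha0eq : a 0 = Yfun (Z L b₁ b₂) (k + 2) / L := by
    rw [ha_def]; simp
  have hY0 : 0 ≤ Yfun (Z L b₁ b₂) (k + 2) := Yfun_nonneg (hT L b₁ b₂ (by omega) hb₁ hb₂) k
  have h6 : ((k + 2 : ℕ) : ℝ) * (q * phi (Z L b₁ b₂) - phi (Z L' b₁ b₂)) ≤
      ((k + 2 : ℕ) : ℝ) * (q * (2 * (Yfun (Z L b₁ b₂) (k + 2) / L))) := by
    apply mul_le_mul_of_nonneg_left _ (by positivity)
    calc q * phi (Z L b₁ b₂) - phi (Z L' b₁ b₂) ≤ q * M := hsl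
      _ ≤ q * (2 * a 0) := mul_le_mul_of_nonneg_left hMle hq0
      _ = q * (2 * (Yfun (Z L b₁ b₂) (k + 2) / L)) := by rw [ha0eq]
  have h7 : ((k + 2 : ℕ) : ℝ) * (q * (2 * (Yfun (Z L b₁ b₂) (k + 2) / L))) =
      (2 * (((k + 2 : ℕ) : ℝ) / L)) * (q * Yfun (Z L b₁ b₂) (k + 2)) := by ring
  have h8 : (2 * (((k + 2 : ℕ) : ℝ) / L)) * (q * Yfun (Z L b₁ b₂) (k + 2)) ≤
      (1 / 2) * (q * Yfun (Z L b₁ b₂) (k + 2)) :=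
    mul_le_mul_of_nonneg_right (by linarith) (by positivity)
  linarith [h5, h6, h7, h8]


/-- `4 ≤ squaringConst`. -/
theorem four_le_squaringConst : 4 ≤ squaringConst := by
  unfold squaringConst
  have := Real.add_one_le_exp (432 : ℝ)
  nlinarith

theorem squaringConst_pos : 0 < squaringConst := lt_of_lt_of_le (by norm_num) four_le_squaringConst

/-- **THE ABSTRACT ASPECT-RATIO BOOTSTRAP** (kernel-checked, sorry-free): for every axis-symmetric, trace-positive
family with volume bounds, the cold defect squares under spatial extension `L ↦ L' ∈ [2L, 4L]`, `L ≥ 8`, with the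
universal constant `squaringConst = 2·432²·e^{432}`. -/
theorem defectSquaring (Z : ℕ → ℕ → ℕ → ℕ → ℝ) (hS : IsAxisSymmetric Z) (hT : IsTracePositive Z)
    (hV : HasVolumeBounds Z) (L : ℕ) (hL : 8 ≤ L) (L' : ℕ) (h₁ : 2 * L ≤ L') (h₂ : L' ≤ 4 * L) :
    boxDefect Z L' ≤ squaringConst * boxDefect Z L ^ 2 := by
  obtain ⟨k, hk⟩ : ∃ k, L / 4 = k + 2 := ⟨L / 4 - 2, by omega⟩
  obtain ⟨k', hk'⟩ : ∃ k', L' / 4 = k' + 2 := ⟨L' / 4 - 2, by omega⟩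
  have hkk' : 2 * k + 2 ≤ k' := by omega
  have hLpos : 0 < L := by omega
  have hL'pos : 0 < L' := by omega
  have hLL' : L ≤ L' := by omega
  have hL2 : 2 ≤ L := by omega
  have hL'2 : 2 ≤ L' := by omega
  have hz : HasSpectralDatum (Z L L L) := hT L L L hL2 hL2 hL2
  have hz' : HasSpectralDatum (Z L' L' L') := hT L' L' L' hL'2 hL'2 hL'2
  simp only [boxDefect, hk, hk']
  obtain ⟨hδ0, -, -, hδx⟩ := defect_facts hz k
  obtain ⟨-, hδ'1, hδ'x, -⟩ := defect_facts hz' k'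
  have hC4 := four_le_squaringConst
  set δ : ℝ := 1 - Z L L L (2 * (k + 2)) / Z L L L (k + 2) ^ 2 with hδdef
  set δ' : ℝ := 1 - Z L' L' L' (2 * (k' + 2)) / Z L' L' L' (k' + 2) ^ 2 with hδ'def
  by_cases hhalf : 1 / 2 ≤ δ
  · have h1 : 1 / 4 ≤ δ ^ 2 := by nlinarith
    have h2 : 1 ≤ squaringConst * δ ^ 2 := by nlinarith
    linarith
  push_neg at hhalf
  -- purity of the small cube: `y ≤ x_t ≤ 2δ`
  have hx : exc (Z L L L) (k + 2) ≤ 2 * δ := hδx δ hhalf.le le_rfl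
  have hy : Yfun (Z L L L) (k + 2) ≤ 2 * δ := (Yfun_le_exc hz k).trans hx
  have hy0 : 0 ≤ Yfun (Z L L L) (k + 2) := Yfun_nonneg hz k
  -- the three side extensions, moving the short side to slot 0 by [Sym]
  have hLr : (0 : ℝ) < L := by exact_mod_cast hLpos
  have hq : (L' : ℝ) / L ≤ 4 := by
    rw [div_le_iff₀ hLr]
    have : ((L' : ℕ) : ℝ) ≤ ((4 * L : ℕ) : ℝ) := by exact_mod_cast h₂
    push_cast at this
    linarith
  have hq0 : 0 ≤ (L' : ℝ) / L := by positivity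
  have e1 := extension_le hS hT hV hL2 hL2 hL hLL'
  have e2 := extension_le hS hT hV hL'2 hL2 hL hLL'
  have e3 := extension_le hS hT hV hL'2 hL'2 hL hLL'
  rw [hk] at e1 e2 e3
  have s1 : Z L' L L = Z L L' L := funext fun τ => (hS L' L L τ).2.1
  have s2 : Z L' L' L = Z L L' L' := funext fun τ => (hS L' L' L τ).2.2
  rw [s1] at e1
  rw [s2] at e2
  have hY' : Yfun (Z L' L' L') (k + 2) ≤ 216 * Yfun (Z L L L) (k + 2) := by
    set q : ℝ := (L' : ℝ) / L
    calc Yfun (Z L' L' L') (k + 2) ≤ 3 / 2 * q * Yfun (Z L L' L') (k + 2) := e3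
      _ ≤ 3 / 2 * q * (3 / 2 * q * Yfun (Z L L' L) (k + 2)) := mul_le_mul_of_nonneg_left e2 (by positivity)
      _ ≤ 3 / 2 * q * (3 / 2 * q * (3 / 2 * q * Yfun (Z L L L) (k + 2))) :=
          mul_le_mul_of_nonneg_left (mul_le_mul_of_nonneg_left e1 (by positivity)) (by positivity)
      _ = 27 / 8 * q ^ 3 * Yfun (Z L L L) (k + 2) := by ring
      _ ≤ 27 / 8 * 4 ^ 3 * Yfun (Z L L L) (k + 2) := by gcongr
      _ = 216 * Yfun (Z L L L) (k + 2) := by norm_num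
  -- time doubling squares the excess of the big cube
  have hx't : exc (Z L' L' L') (k + 2) ≤ Real.exp (432 * δ) - 1 := by
    rw [exc_eq_exp_Yfun hz' k]
    have : Yfun (Z L' L' L') (k + 2) ≤ 432 * δ := by linarith
    linarith [Real.exp_le_exp.2 this]
  have hx't0 : 0 ≤ exc (Z L' L' L') (k + 2) := exc_nonneg hz' k
  have hx'T : exc (Z L' L' L') (k' + 2) ≤ exc (Z L' L' L') (k + 2) ^ 2 :=
    calc exc (Z L' L' L') (k' + 2) ≤ exc (Z L' L' L') (2 * k + 2 + 2) := exc_antitone hz' hkk'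
      _ = exc (Z L' L' L') (2 * (k + 2)) := by ring_nf
      _ ≤ exc (Z L' L' L') (k + 2) ^ 2 := exc_two_mul_le_sq hz' k
  have hu : Real.exp (432 * δ) - 1 ≤ 432 * δ * Real.exp (432 * δ) := exp_sub_one_le (by linarith)
  have hu0 : 0 ≤ Real.exp (432 * δ) - 1 := by linarith [Real.add_one_le_exp (432 * δ)]
  have hmain : δ' ≤ 2 * (432 * δ * Real.exp (432 * δ)) ^ 2 :=
    calc δ' ≤ 2 * exc (Z L' L' L') (k' + 2) := hδ'x
      _ ≤ 2 * exc (Z L' L' L') (k + 2) ^ 2 := by linarith [hx'T]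
      _ ≤ 2 * (Real.exp (432 * δ) - 1) ^ 2 := by gcongr
      _ ≤ 2 * (432 * δ * Real.exp (432 * δ)) ^ 2 := by gcongr
  have hexp2 : Real.exp (432 * δ) ^ 2 ≤ Real.exp 432 := by
    rw [← Real.exp_nat_mul]
    exact Real.exp_le_exp.2 (by push_cast; linarith)
  have e5 : 2 * (432 * δ * Real.exp (432 * δ)) ^ 2 = 2 * 432 ^ 2 * δ ^ 2 * Real.exp (432 * δ) ^ 2 := by ring
  have e6 : 2 * 432 ^ 2 * δ ^ 2 * Real.exp (432 * δ) ^ 2 ≤ 2 * 432 ^ 2 * δ ^ 2 * Real.exp 432 :=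
    mul_le_mul_of_nonneg_left hexp2 (by positivity)
  unfold squaringConst
  linarith

end Family

/-! ## §2 The model: Wilson's anisotropic four-torus is such a family — [Sym] and [Vol] PROVED (rev 2); [TM-aniso] the one stub -/

section Model

variable {G : Type} [Group G] [TopologicalSpace G] [IsTopologicalGroup G] [CompactSpace G]
  [MeasurableSpace G] [BorelSpace G]

/-- `coldDefect` IS `boxDefect` of the Wilson family (definitional). -/
theorem coldDefect_eq_boxDefect {N : ℕ} (ρ : G →* Matrix (Fin N) (Fin N) ℂ) (β : ℝ) (L : ℕ) :
    coldDefect ρ β L = boxDefect (wilsonFinTorusPartition ρ β) L := rfl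

/-! ### [Sym] PROVED (rev 2): axis-permutation symmetry of `wilsonFinTorusPartition`
Relabel the links along a coordinate permutation `e` of the sites that is shift-equivariant for a direction permutation
`σ` (`e (x + e_μ) = e x + e_{σ μ}`); the product Haar measure is invariant (`measurePreserving_piCongrLeft`); a plaquette
whose orientation flips becomes its inverse and `Re tr ρ(U⁻¹) = Re tr ρ(U)` (`CompactGroup.re_trace_map_inv`), which is
absorbed by writing the plaquette sum as half the sum over ordered pairs `μ ≠ ν`. -/

omit [TopologicalSpace G] [IsTopologicalGroup G] [CompactSpace G] [MeasurableSpace G] [BorelSpace G] in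
/-- `pl(x,ν,μ) = pl(x,μ,ν)⁻¹`. -/
theorem finTorusPlaquette_swap {a b c d : ℕ} (U : FinTorusSite a b c d × Fin 4 → G) (x : FinTorusSite a b c d)
    (μ ν : Fin 4) : finTorusPlaquette U x ν μ = (finTorusPlaquette U x μ ν)⁻¹ := by
  simp [finTorusPlaquette, mul_assoc]

/-- half-sum over ordered pairs: for a symmetric `g` on `Fin 4`, `Σ_{μ<ν} g = ½ Σ_{μ≠ν} g`. -/
theorem sum_pairs_eq_half (g : Fin 4 → Fin 4 → ℝ) (hg : ∀ μ ν, g μ ν = g ν μ) :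
    ∑ q : {q : Fin 4 × Fin 4 // q.1 < q.2}, g q.1.1 q.1.2 =
      (1 / 2) * ∑ μ : Fin 4, ∑ ν : Fin 4, if μ = ν then 0 else g μ ν := by
  have h1 : ∑ q : {q : Fin 4 × Fin 4 // q.1 < q.2}, g q.1.1 q.1.2 =
      ∑ q ∈ (Finset.univ : Finset (Fin 4 × Fin 4)).filter (fun q => q.1 < q.2), g q.1 q.2 :=
    (Finset.sum_subtype ((Finset.univ : Finset (Fin 4 × Fin 4)).filter (fun q => q.1 < q.2))
      (fun q => by simp) (fun q : Fin 4 × Fin 4 => g q.1 q.2)).symm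
  rw [h1, Finset.sum_filter, Fintype.sum_prod_type]
  simp only [Fin.sum_univ_four]
  simp only [Fin.lt_iff_val_lt_val, Fin.ext_iff]
  norm_num
  linarith [hg 1 0, hg 2 0, hg 3 0, hg 2 1, hg 3 1, hg 3 2]

/-- **Relabelling invariance**: a coordinate permutation `e` of the sites, equivariant for the shifts along a direction
permutation `σ`, leaves the Wilson partition function invariant (flipped plaquettes invert; `Re tr ρ(U⁻¹) = Re tr ρ(U)`). -/
theorem partition_eq_of_equivariant {a b c d a' b' c' d' : ℕ} (e : FinTorusSite a b c d ≃ FinTorusSite a' b' c' d')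
    (σ : Equiv.Perm (Fin 4)) (he : ∀ x μ, e (x.shift μ) = (e x).shift (σ μ)) (r : LatticeRep G) (β : ℝ) :
    wilsonFinTorusPartition r.ρ β a' b' c' d' = wilsonFinTorusPartition r.ρ β a b c d := by
  classical
  set E : FinTorusSite a b c d × Fin 4 ≃ FinTorusSite a' b' c' d' × Fin 4 := e.prodCongr σ with hE
  set T : (FinTorusSite a b c d × Fin 4 → G) ≃ᵐ (FinTorusSite a' b' c' d' × Fin 4 → G) :=
    MeasurableEquiv.piCongrLeft (fun _ : FinTorusSite a' b' c' d' × Fin 4 => G) E with hT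
  have hTcoe : ∀ U l', T U l' = U (E.symm l') := fun U l' => by
    rw [hT, MeasurableEquiv.coe_piCongrLeft, Equiv.piCongrLeft_apply_eq_cast, cast_eq]
  have hMP : MeasurePreserving T
      (Measure.pi fun _ : FinTorusSite a b c d × Fin 4 => haarProbability G)
      (Measure.pi fun _ : FinTorusSite a' b' c' d' × Fin 4 => haarProbability G) :=
    measurePreserving_piCongrLeft (fun _ : FinTorusSite a' b' c' d' × Fin 4 => haarProbability G) E
  -- plaquettes transform covariantly
  have hpl : ∀ (U : FinTorusSite a b c d × Fin 4 → G) (x : FinTorusSite a b c d) (μ ν : Fin 4),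
      finTorusPlaquette (T U) (e x) (σ μ) (σ ν) = finTorusPlaquette U x μ ν := fun U x μ ν => by
    simp only [finTorusPlaquette, hTcoe, ← he, hE, Equiv.prodCongr_symm, Equiv.prodCongr_apply,
      Prod.map_apply, Equiv.symm_apply_apply]
  have hre : ∀ g : G, ((r.ρ g⁻¹).trace).re = ((r.ρ g).trace).re := fun g =>
    Literature.RepresentationTheory.CompactGroups.CompactGroup.re_trace_map_inv r.ρ r.continuous g
  -- the action is invariant
  have hS : ∀ U : FinTorusSite a b c d × Fin 4 → G,
      (∑ x : FinTorusSite a' b' c' d', ∑ q : {q : Fin 4 × Fin 4 // q.1 < q.2},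
        ((r.N : ℝ) - (r.ρ (finTorusPlaquette (T U) x q.1.1 q.1.2)).trace.re)) =
      ∑ x : FinTorusSite a b c d, ∑ q : {q : Fin 4 × Fin 4 // q.1 < q.2},
        ((r.N : ℝ) - (r.ρ (finTorusPlaquette U x q.1.1 q.1.2)).trace.re) := fun U => by
    rw [← Equiv.sum_comp e]
    refine Finset.sum_congr rfl fun x _ => ?_
    have sym1 : ∀ μ ν, ((r.N : ℝ) - (r.ρ (finTorusPlaquette (T U) (e x) μ ν)).trace.re) =
        ((r.N : ℝ) - (r.ρ (finTorusPlaquette (T U) (e x) ν μ)).trace.re) := fun μ ν => by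
      rw [finTorusPlaquette_swap (T U) (e x) μ ν, hre]
    have sym2 : ∀ μ ν, ((r.N : ℝ) - (r.ρ (finTorusPlaquette U x μ ν)).trace.re) =
        ((r.N : ℝ) - (r.ρ (finTorusPlaquette U x ν μ)).trace.re) := fun μ ν => by
      rw [finTorusPlaquette_swap U x μ ν, hre]
    rw [sum_pairs_eq_half (fun μ ν => (r.N : ℝ) - (r.ρ (finTorusPlaquette (T U) (e x) μ ν)).trace.re) sym1,
      sum_pairs_eq_half (fun μ ν => (r.N : ℝ) - (r.ρ (finTorusPlaquette U x μ ν)).trace.re) sym2]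
    congr 1
    rw [← Equiv.sum_comp σ]
    refine Finset.sum_congr rfl fun μ _ => ?_
    rw [← Equiv.sum_comp σ]
    refine Finset.sum_congr rfl fun ν _ => ?_
    simp only [Equiv.apply_eq_iff_eq, hpl]
  unfold wilsonFinTorusPartition
  rw [← hMP.integral_comp']
  refine integral_congr_ae (Eventually.of_forall fun U => ?_)
  simp only [hS U]

/-- the three transpositions as shift-equivariant site permutations -/
def e03 (a b c d : ℕ) : FinTorusSite a b c d ≃ FinTorusSite d b c a where
  toFun x := (x.2.2.2, x.2.1, x.2.2.1, x.1)
  invFun y := (y.2.2.2, y.2.1, y.2.2.1, y.1)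
  left_inv x := rfl
  right_inv y := rfl

def e01 (a b c d : ℕ) : FinTorusSite a b c d ≃ FinTorusSite b a c d where
  toFun x := (x.2.1, x.1, x.2.2.1, x.2.2.2)
  invFun y := (y.2.1, y.1, y.2.2.1, y.2.2.2)
  left_inv x := rfl
  right_inv y := rfl

def e02 (a b c d : ℕ) : FinTorusSite a b c d ≃ FinTorusSite c b a d where
  toFun x := (x.2.2.1, x.2.1, x.1, x.2.2.2)
  invFun y := (y.2.2.1, y.2.1, y.1, y.2.2.2)
  left_inv x := rfl
  right_inv y := rfl

theorem e03_shift (a b c d : ℕ) (x : FinTorusSite a b c d) (μ : Fin 4) :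
    e03 a b c d (x.shift μ) = (e03 a b c d x).shift (Equiv.swap 0 3 μ) := by
  fin_cases μ <;> simp [e03, FinTorusSite.shift, Equiv.swap_apply_def] <;> decide

theorem e01_shift (a b c d : ℕ) (x : FinTorusSite a b c d) (μ : Fin 4) :
    e01 a b c d (x.shift μ) = (e01 a b c d x).shift (Equiv.swap 0 1 μ) := by
  fin_cases μ <;> simp [e01, FinTorusSite.shift, Equiv.swap_apply_def] <;> decide

theorem e02_shift (a b c d : ℕ) (x : FinTorusSite a b c d) (μ : Fin 4) :
    e02 a b c d (x.shift μ) = (e02 a b c d x).shift (Equiv.swap 0 2 μ) := by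
  fin_cases μ <;> simp [e02, FinTorusSite.shift, Equiv.swap_apply_def] <;> decide

/-- [Sym] PROVED: axis-permutation symmetry of the anisotropic Wilson partition function. -/
theorem axisSymmetric (r : LatticeRep G) (β : ℝ) : IsAxisSymmetric (wilsonFinTorusPartition r.ρ β) :=
  fun a b c d =>
    ⟨(partition_eq_of_equivariant (e03 a b c d) (Equiv.swap 0 3) (e03_shift a b c d) r β).symm,
     (partition_eq_of_equivariant (e01 a b c d) (Equiv.swap 0 1) (e01_shift a b c d) r β).symm,
     (partition_eq_of_equivariant (e02 a b c d) (Equiv.swap 0 2) (e02_shift a b c d) r β).symm⟩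

/-! ### [Vol] PROVED (rev 2): `e^{−12 N β · n₀n₁n₂n₃} ≤ Z ≤ 1` at `β ≥ 0`
(`|Re tr ρ(U)| ≤ N` for the unitary `r.ρ` — `CompactGroup.abs_re_trace_le_card`; normalised Haar product measure;
`6·n₀n₁n₂n₃` plaquettes; integrability from continuity on the compact configuration space as in
`wilsonFinTorusPartition_pos`). -/

/-- pointwise bounds on the Wilson weight of the anisotropic torus: `e^{−12Nβ·vol} ≤ e^{−β S(U)} ≤ 1` (`β ≥ 0`, unitary `ρ`). -/
theorem wilsonWeight_bounds (r : LatticeRep G) {β : ℝ} (hβ : 0 ≤ β) (a b c d : ℕ)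
    (U : FinTorusSite a b c d × Fin 4 → G) :
    Real.exp (-(12 * r.N * β * ((a * b * c * d : ℕ) : ℝ))) ≤
      Real.exp (-β * ∑ x : FinTorusSite a b c d, ∑ q : {q : Fin 4 × Fin 4 // q.1 < q.2},
        ((r.N : ℝ) - (r.ρ (finTorusPlaquette U x q.1.1 q.1.2)).trace.re)) ∧
    Real.exp (-β * ∑ x : FinTorusSite a b c d, ∑ q : {q : Fin 4 × Fin 4 // q.1 < q.2},
        ((r.N : ℝ) - (r.ρ (finTorusPlaquette U x q.1.1 q.1.2)).trace.re)) ≤ 1 := by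
  classical
  have htr : ∀ g : G, |((r.ρ g).trace).re| ≤ r.N := fun g => by
    have := Literature.RepresentationTheory.CompactGroups.CompactGroup.abs_re_trace_le_card r.ρ r.continuous g
    simpa using this
  set S : ℝ := ∑ x : FinTorusSite a b c d, ∑ q : {q : Fin 4 × Fin 4 // q.1 < q.2},
        ((r.N : ℝ) - (r.ρ (finTorusPlaquette U x q.1.1 q.1.2)).trace.re) with hS
  have hS0 : 0 ≤ S := Finset.sum_nonneg fun x _ => Finset.sum_nonneg fun q _ => by
    have := (abs_le.1 (htr (finTorusPlaquette U x q.1.1 q.1.2))).2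
    linarith
  have hq6 : Fintype.card {q : Fin 4 × Fin 4 // q.1 < q.2} = 6 := by decide
  have hS1 : S ≤ 12 * r.N * ((a * b * c * d : ℕ) : ℝ) := by
    calc S ≤ ∑ _x : FinTorusSite a b c d, ∑ _q : {q : Fin 4 × Fin 4 // q.1 < q.2}, (2 * (r.N : ℝ)) :=
          Finset.sum_le_sum fun x _ => Finset.sum_le_sum fun q _ => by
            have := (abs_le.1 (htr (finTorusPlaquette U x q.1.1 q.1.2))).1
            linarith
      _ = (Fintype.card (FinTorusSite a b c d) : ℝ) * (6 * (2 * (r.N : ℝ))) := by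
          simp only [Finset.sum_const, Finset.card_univ, nsmul_eq_mul, hq6]
          push_cast
          ring
      _ = 12 * r.N * ((a * b * c * d : ℕ) : ℝ) := by
          simp only [FinTorusSite, Fintype.card_prod, Fintype.card_fin]
          push_cast
          ring
  constructor
  · exact Real.exp_le_exp.2 (by nlinarith [mul_le_mul_of_nonneg_left hS1 hβ])
  · exact Real.exp_le_one_iff.2 (by nlinarith)

/-- [Vol] PROVED: `e^{−12 N β · n₀n₁n₂n₃} ≤ Z ≤ 1` at `β ≥ 0`. -/
theorem volumeBounds (r : LatticeRep G) {β : ℝ} (hβ : 0 ≤ β) :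
    HasVolumeBounds (wilsonFinTorusPartition r.ρ β) := by
  classical
  haveI : SecondCountableTopology G :=
    (r.continuous.isClosedEmbedding r.injective).isEmbedding.secondCountableTopology
  refine ⟨12 * r.N * β, fun a b c d _ _ _ _ => ?_⟩
  unfold wilsonFinTorusPartition
  -- continuity ⇒ integrability of the weight (as in `wilsonFinTorusPartition_pos`)
  have hU : ∀ l : FinTorusSite a b c d × Fin 4,
      Continuous fun U : FinTorusSite a b c d × Fin 4 → G => U l := fun l => continuous_apply l
  have hpl : ∀ (x : FinTorusSite a b c d) (μ ν : Fin 4),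
      Continuous fun U : FinTorusSite a b c d × Fin 4 → G => finTorusPlaquette U x μ ν := fun x μ ν =>
    (((hU _).mul (hU _)).mul (hU _).inv).mul (hU _).inv
  have htr : Continuous fun g : G => (r.ρ g).trace.re :=
    Complex.continuous_re.comp (Continuous.matrix_trace r.continuous)
  have hc : Continuous fun U : FinTorusSite a b c d × Fin 4 → G =>
      Real.exp (-β * ∑ x : FinTorusSite a b c d, ∑ q : {q : Fin 4 × Fin 4 // q.1 < q.2},
        ((r.N : ℝ) - (r.ρ (finTorusPlaquette U x q.1.1 q.1.2)).trace.re)) :=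
    Real.continuous_exp.comp (continuous_const.mul (continuous_finsetSum _ fun x _ =>
      continuous_finsetSum _ fun q _ => continuous_const.sub (htr.comp (hpl x _ _))))
  have hint := hc.integrable_of_hasCompactSupport (μ := Measure.pi fun _ : FinTorusSite a b c d × Fin 4 =>
      haarProbability G)
    (IsCompact.of_isClosed_subset isCompact_univ (isClosed_tsupport _) (Set.subset_univ _))
  constructor
  · have h := integral_mono (integrable_const _) hint fun U => (wilsonWeight_bounds r hβ a b c d U).1
    simpa using h
  · have h := integral_mono hint (integrable_const _) fun U => (wilsonWeight_bounds r hβ a b c d U).2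
    simpa using h

end Model

/-! ## §3 The composition, PROVED: `defectSquaring` + [Sym] + [Vol] ⇒ ([TM-aniso] → R) -/

/-- **R from the model facts** (real proof): given the three model facts for every simply-connected compact simple `G`,
every `r` and every `β ≥ 0`, `ColdDoublingRecursionSC` holds with `C = squaringConst`, `β₀ = 0`, `L₀ = 8`, by the
sorry-free `defectSquaring`. -/
theorem coldDoublingRecursionSC_of_model
    (hSym : ∀ (G : Type) [Group G] [TopologicalSpace G] [IsTopologicalGroup G] [CompactSpace G] [MeasurableSpace G]
      [BorelSpace G] (r : LatticeRep G) (β : ℝ), IsAxisSymmetric (wilsonFinTorusPartition r.ρ β))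
    (hTM : ∀ (G : Type) [Group G] [TopologicalSpace G] [IsTopologicalGroup G] [CompactSpace G] [MeasurableSpace G]
      [BorelSpace G] (r : LatticeRep G) (β : ℝ), 0 ≤ β → IsTracePositive (wilsonFinTorusPartition r.ρ β))
    (hVol : ∀ (G : Type) [Group G] [TopologicalSpace G] [IsTopologicalGroup G] [CompactSpace G] [MeasurableSpace G]
      [BorelSpace G] (r : LatticeRep G) (β : ℝ), 0 ≤ β → HasVolumeBounds (wilsonFinTorusPartition r.ρ β)) :
    ColdDoublingRecursionSC := by
  intro G _ _ _ _ _ _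
  letI : MeasurableSpace G := borel G
  haveI : BorelSpace G := ⟨rfl⟩
  intro r
  refine ⟨squaringConst, 0, 8, squaringConst_pos, fun β hβ L hL L' h₁ h₂ => ?_⟩
  rw [coldDefect_eq_boxDefect, coldDefect_eq_boxDefect]
  exact defectSquaring (wilsonFinTorusPartition r.ρ β) (hSym G r β) (hTM G r β hβ) (hVol G r β hβ) L hL L' h₁ h₂

/-- **[TM-aniso] ⇒ R** (headline of this file; NO sorry anywhere): the anisotropic transfer-matrix trace formula for Wilson's
four-torus — `IsTracePositive (wilsonFinTorusPartition r.ρ β)` for every simply-connected compact simple `G`, faithful unitary `r`,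
`β ≥ 0` (the tree has the cubic case `exists_spectralData_wilsonFinTorusPartition`) — implies `ColdDoublingRecursionSC` with the
β-free constant `squaringConst`, `β₀ = 0`, `L₀ = 8`. -/
theorem R_of_tracePositive
    (hTM : ∀ (G : Type) [Group G] [TopologicalSpace G] [IsTopologicalGroup G] [CompactSpace G] [MeasurableSpace G]
      [BorelSpace G] (r : LatticeRep G) (β : ℝ), 0 ≤ β → IsTracePositive (wilsonFinTorusPartition r.ρ β)) :
    ColdDoublingRecursionSC :=
  coldDoublingRecursionSC_of_model (fun G _ _ _ _ _ _ r β => axisSymmetric r β) hTM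
    (fun G _ _ _ _ _ _ r _ hβ => volumeBounds r hβ)

end Summit.QuantumFields.YangMills.Theorems.AspectBootstrap

end
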